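import Summits.QuantumFields.YangMills.Theorems.LuscherReductionTwistedTraceScalingBOStiffQuasimodeModel
import Summits.QuantumFields.YangMills.Theorems.LuscherReductionTwistedTraceScalingBOStiffActionHessian
import Summits.QuantumFields.YangMills.Theorems.LuscherReductionTwistedTraceScalingBOStiffJumpMass
import Summits.QuantumFields.YangMills.Theorems.LuscherReductionTwistedTraceScalingBOStiffCentralFloor
import HarnessLib

/-!
# (B-ST) (W1-10 (A4), part 2) `…BOStiffQuasimodeSlice`: the TWO-SIDED SLICE INTEGRAL of the model jump against the profile, `∫_y cK(x,y)cΘ(y)dπ = (1±σ)·Λ_β·e^{−q_β(x̂)}`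
# (lane A of S-BASE, crux `TwistedTraceScaling` stmt-QuantumFields-20203, C4-CORE, the (B-ST) pen; (A) split (A4); cdisprove R67/R68: exact exponent, absolute o(1))

For `x ∈ cS` (upper) and `x ∈ I = cS ∩ {‖x̂‖ ≤ r_f/12}` (lower), with ONE level `Λ_β = ρ₀·κ_β·Πᵢ√(π/(ãᵢ+b̃ᵢ+π))·(πβ⁻²)^{dim Γ/2}`:
`J(x) := ∫_y cK_β(x,y)·cΘ_β(y) dπ(y) ≤ e^{2ε}(1+ε)·Λ_β·e^{−q_β(x̂)}` on `cS`, `≥ (1 − τ_β)·e^{−2ε}(1−ε)·Λ_β·e^{−q_β(x̂)}` on `I`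
(★ `slice_two_sided_at`, β-pointwise under the (A1) action↔Hessian error `ε` and the sharp `π`-density sandwich `(1±ε)ρ₀`), and its schedule form
★★ `eventually_slice_two_sided`: `∀ σ₁ > 0, ∀ᶠ β, ∃ Λ > 0, J ≤ (1+σ₁)Λe^{−q}` on `cS`, `(1−σ₁)Λe^{−q} ≤ J` on `I`.
Chain: `cΘ = e^{−‖P_Γŷ‖²β²}e^{−q(ŷ)}` on `cS` (✓`cΘ_eq_on_cS`) → (A1) `e^{−(β/2)S} = e^{±ε}e^{−⟨·,(β/2)H·⟩}` (✓`eventually_action_hessian_cS`) → `π = (1±ε)ρ₀·balLebesgue` on `cS`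
(✓`setIntegral_cS_sharp`) → `balLebesgue = κ·vol∘flatMap⁻¹` (✓`setIntegral_cS_balLebesgue_eq_flat`) → dictionary (✓`hessianIntegrand_flatVec`, ✓`flatMap_preimage_cS`) → the exact
completed-square Gaussian (✓`sliceModel_upper`) and its Chernoff-truncated lower bound on the weighted ball (✓`sliceModel_lower`, `θ = β/2`, `wᵢ = γᵢ²`).
HONEST FRAMING: bookkeeping for a stub of a child of the CONDITIONAL route R2b1; (Q±) assembled in the next file; (B-ST), C4-CORE OPEN; not infinite volume, not a gap, not Clay.
-/

set_option autoImplicit false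

noncomputable section

open MeasureTheory Filter Topology Real
open scoped BigOperators RealInnerProductSpace NNReal ENNReal
open Literature.MathematicalPhysics.QuantumFieldTheory
open Literature.MathematicalPhysics.QuantumLattice

namespace Summit.QuantumFields.YangMills.Theorems.FemtoTransferGap.TwoLattice.ConstTube

open Summit.QuantumFields.YangMills.Theorems.FemtoTransferGap
open Summit.QuantumFields.YangMills.Theorems.FemtoTransferGap.TwoLattice
open Summit.QuantumFields.YangMills.Theorems.FemtoTransferGap.TwoLattice.Stiff
open Summit.QuantumFields.YangMills.Theorems.FemtoTransferGap.TwoLattice.GnChart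

variable {L : ℕ} [NeZero L]

/-! ## §1 Small facts -/

/-- The Hessian-form slice integrand is continuous in `y`. [folklore] -/
theorem continuous_hessForm (β s : ℝ) (X : LinkSpace L) :
    Continuous fun y : Edge 3 L → Fin 3 → ℝ =>
      Real.exp (-⟪X, ((β / 2) • stiffHessian L) X⟫) * Real.exp (-⟪linkEmbed L y, ((β / 2) • stiffHessian L) (linkEmbed L y)⟫) *
        Real.exp (-(β * ‖(X - linkEmbed L y) - (gaugeModes L).starProjection (X - linkEmbed L y)‖ ^ 2)) *
        Real.exp (-(‖(gaugeModes L).starProjection (linkEmbed L y)‖ ^ 2 / s ^ 2)) * Real.exp (-(stiffGaussExp L (β / 2) β (linkEmbed L y))) := by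
  have hl : Continuous fun y : Edge 3 L → Fin 3 → ℝ => linkEmbed L y := (linkEmbed L).continuous_of_finiteDimensional
  have hH : Continuous fun v : LinkSpace L => ((β / 2) • stiffHessian L) v := ((β / 2) • stiffHessian L).continuous_of_finiteDimensional
  have hP : Continuous fun v : LinkSpace L => (gaugeModes L).starProjection v := (gaugeModes L).starProjection.continuous
  have hd : Continuous fun y : Edge 3 L → Fin 3 → ℝ => X - linkEmbed L y := continuous_const.sub hl
  refine (((continuous_const.mul (hl.inner (hH.comp hl)).neg.rexp).mul ?_).mul ?_).mul (continuous_stiffGaussExp (β / 2) β |>.comp hl).neg.rexp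
  · exact (continuous_const.mul ((hd.sub (hP.comp hd)).norm.pow 2)).neg.rexp
  · exact (((hP.comp hl).norm.pow 2).div_const _).neg.rexp

/-- The Hessian-form slice integrand lies in `[0, 1]`. [folklore] -/
theorem hessForm_mem_Icc {β : ℝ} (hβ : 0 ≤ β) (s : ℝ) (X : LinkSpace L) (y : Edge 3 L → Fin 3 → ℝ) :
    0 ≤ Real.exp (-⟪X, ((β / 2) • stiffHessian L) X⟫) * Real.exp (-⟪linkEmbed L y, ((β / 2) • stiffHessian L) (linkEmbed L y)⟫) *
        Real.exp (-(β * ‖(X - linkEmbed L y) - (gaugeModes L).starProjection (X - linkEmbed L y)‖ ^ 2)) *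
        Real.exp (-(‖(gaugeModes L).starProjection (linkEmbed L y)‖ ^ 2 / s ^ 2)) * Real.exp (-(stiffGaussExp L (β / 2) β (linkEmbed L y))) ∧
      Real.exp (-⟪X, ((β / 2) • stiffHessian L) X⟫) * Real.exp (-⟪linkEmbed L y, ((β / 2) • stiffHessian L) (linkEmbed L y)⟫) *
        Real.exp (-(β * ‖(X - linkEmbed L y) - (gaugeModes L).starProjection (X - linkEmbed L y)‖ ^ 2)) *
        Real.exp (-(‖(gaugeModes L).starProjection (linkEmbed L y)‖ ^ 2 / s ^ 2)) * Real.exp (-(stiffGaussExp L (β / 2) β (linkEmbed L y))) ≤ 1 := by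
  have hβ2 : 0 ≤ β / 2 := by positivity
  have h1 : Real.exp (-⟪X, ((β / 2) • stiffHessian L) X⟫) ≤ 1 := Real.exp_le_one_iff.2 (by linarith [inner_smul_stiffHessian_nonneg (L := L) hβ2 X])
  have h2 : Real.exp (-⟪linkEmbed L y, ((β / 2) • stiffHessian L) (linkEmbed L y)⟫) ≤ 1 :=
    Real.exp_le_one_iff.2 (by linarith [inner_smul_stiffHessian_nonneg (L := L) hβ2 (linkEmbed L y)])
  have h3 : Real.exp (-(β * ‖(X - linkEmbed L y) - (gaugeModes L).starProjection (X - linkEmbed L y)‖ ^ 2)) ≤ 1 := Real.exp_le_one_iff.2 (by nlinarith [sq_nonneg ‖(X - linkEmbed L y) - (gaugeModes L).starProjection (X - linkEmbed L y)‖])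
  have h4 : Real.exp (-(‖(gaugeModes L).starProjection (linkEmbed L y)‖ ^ 2 / s ^ 2)) ≤ 1 :=
    Real.exp_le_one_iff.2 (by linarith [div_nonneg (sq_nonneg ‖(gaugeModes L).starProjection (linkEmbed L y)‖) (sq_nonneg s)])
  have h5 : Real.exp (-(stiffGaussExp L (β / 2) β (linkEmbed L y))) ≤ 1 := Real.exp_le_one_iff.2 (by linarith [stiffGaussExp_nonneg (L := L) (β / 2) β (linkEmbed L y)])
  exact ⟨by positivity, mul_le_one₀ (mul_le_one₀ (mul_le_one₀ (mul_le_one₀ h1 (Real.exp_pos _).le h2) (Real.exp_pos _).le h3) (Real.exp_pos _).le h4)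
    (Real.exp_pos _).le h5⟩

/-- (A1) at the exponential level: `|a − b| ≤ ε ⇒ e^{−ε}e^{−b} ≤ e^{−a} ≤ e^{ε}e^{−b}`. [folklore] -/
theorem exp_neg_sandwich_of_abs_sub_le {a b ε : ℝ} (h : |a - b| ≤ ε) :
    Real.exp (-ε) * Real.exp (-b) ≤ Real.exp (-a) ∧ Real.exp (-a) ≤ Real.exp ε * Real.exp (-b) := by
  rw [← Real.exp_add, ← Real.exp_add]
  obtain ⟨h1, h2⟩ := abs_le.mp h
  exact ⟨Real.exp_le_exp.2 (by linarith), Real.exp_le_exp.2 (by linarith)⟩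

/-! ## §2 The β-pointwise two-sided slice bound -/

set_option maxHeartbeats 1600000 in
-- one long chain of integral comparisons with record-size integrands.
/-- ★★ **TWO-SIDED SLICE INTEGRAL, β-pointwise**: for `β ≥ 1`, `0 < ε < 1`, under the (A1) error `ε` on `cS` and the `π`-density sandwich `(1±ε)ρ₀` on `cS`, there is ONE
`Λ > 0` with `∫_y cK(x,y)cΘ(y)dπ ≤ e^{2ε}(1+ε)·Λ·e^{−q_β(x̂)}` for `x ∈ cS` and `(1 − τ_β)·e^{−2ε}(1−ε)·Λ·e^{−q_β(x̂)} ≤ ∫_y cK(x,y)cΘ(y)dπ` for `x ∈ cS`, `‖x̂‖ ≤ r_f/12`,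
`τ_β = √2^{3|E|}e^{−βr_f²/8} + 2^{dim Γ/2}e^{−r_f²β²/8}` (`r_f = min(1/40, β^{-1/2}ℓ)`). [cite: Wipf2021, §8.5.1 (8.56)–(8.57)] -/
theorem slice_two_sided_at {β : ℝ} (hβ : 1 ≤ β) {ε : ℝ} (hε0 : 0 < ε) (hε1 : ε < 1) {ρ₀ : ℝ} (hρ₀ : 0 < ρ₀)
    (hA1 : ∀ y ∈ cS L β, |β / 2 * wilsonAction su2Rep (orthoTube L 1 y) - ⟪linkEmbed L y, ((β / 2) • stiffHessian L) (linkEmbed L y)⟫| ≤ ε)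
    (hπ : ∀ f : (Edge 3 L → Fin 3 → ℝ) → ℝ, Measurable f → (∀ x, 0 ≤ f x) → (∃ C : ℝ, ∀ x, f x ≤ C) →
      (1 - ε) * ρ₀ * ∫ x in cS L β, f x ∂balLebesgue L ≤ ∫ x in cS L β, f x ∂orthoTransverse L ∧
        ∫ x in cS L β, f x ∂orthoTransverse L ≤ (1 + ε) * ρ₀ * ∫ x in cS L β, f x ∂balLebesgue L) :
    ∃ Λ : ℝ, 0 < Λ ∧
      (∀ x ∈ cS L β, ∫ y, cK L β x y * cΘ L β y ∂orthoTransverse L ≤ Real.exp (2 * ε) * (1 + ε) * Λ * Real.exp (-(stiffGaussExp L (β / 2) β (linkEmbed L x)))) ∧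
      (∀ x ∈ cS L β, ‖linkEmbed L x‖ ≤ min (1 / 40) (powScale (1 / 2) β * btLog β) / 12 →
        (1 - Real.sqrt 2 ^ Fintype.card (Edge 3 L × Fin 3) * Real.exp (-(β / 2 * ((min (1 / 40) (powScale (1 / 2) β * btLog β)) ^ 2 / 4))) -
            Real.exp (-((min (1 / 40) (powScale (1 / 2) β * btLog β)) ^ 2 / 4 / (2 * powScale 1 β ^ 2))) * (2 : ℝ) ^ ((Module.finrank ℝ (gaugeModes L) : ℝ) / 2)) *
          (Real.exp (-(2 * ε)) * (1 - ε)) * Λ * Real.exp (-(stiffGaussExp L (β / 2) β (linkEmbed L x))) ≤ ∫ y, cK L β x y * cΘ L β y ∂orthoTransverse L) := by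
  haveI := isFiniteMeasure_orthoTransverse L
  have hβ0 : 0 < β := by linarith
  have hs0 : 0 < powScale 1 β := powScale_pos 1 β
  have hr0 : 0 ≤ min (1 / 40) (powScale (1 / 2) β * btLog β) := le_min (by norm_num) (mul_nonneg (powScale_pos _ _).le (zero_le_one.trans (one_le_btLog β)))
  have hr2 : min (1 / 40) (powScale (1 / 2) β * btLog β) ≤ 1 / 2 := (min_le_left _ _).trans (by norm_num)
  obtain ⟨κ, hκ, hflat⟩ := setIntegral_cS_balLebesgue_eq_flat (L := L) hβ0
  have hSm : MeasurableSet (cS L β) := measurableSet_cS β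
  have hvol : (volume : Measure ((StiffIdx L β → ℝ) × gaugeModes L)) = (volume : Measure (StiffIdx L β → ℝ)).prod (volume : Measure (gaugeModes L)) := rfl
  have hTm : Measurable (flatMap L β : ((StiffIdx L β → ℝ) × gaugeModes L) → (Edge 3 L → Fin 3 → ℝ)) := (LinearMap.continuous_of_finiteDimensional _).measurable
  -- the flat data
  have hfa := fun i : StiffIdx L β => flatA_sq_add (L := L) hβ0 i
  have ha : ∀ i : StiffIdx L β, 0 ≤ flatA L β i := fun i => (hfa i).1.le
  have hb : ∀ i : StiffIdx L β, 0 < flatB L β i := fun i => (hfa i).2.1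
  have hc0 : ∀ _i : StiffIdx L β, (0 : ℝ) ≤ π := fun _ => Real.pi_pos.le
  have hc : ∀ i : StiffIdx L β, π ^ 2 = flatA L β i ^ 2 + 2 * flatA L β i * flatB L β i := fun i => (hfa i).2.2.symm
  -- the flat constant
  set G : ℝ := (∏ i : StiffIdx L β, Real.sqrt (π / (flatA L β i + flatB L β i + π))) * (π * powScale 1 β ^ 2) ^ ((Module.finrank ℝ (gaugeModes L) : ℝ) / 2) with hG
  have hG0 : 0 < G :=
    mul_pos (Finset.prod_pos fun i _ => Real.sqrt_pos.mpr (div_pos Real.pi_pos (by linarith [ha i, hb i, Real.pi_pos]))) (Real.rpow_pos_of_pos (by positivity) _)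
  -- everything for one `x ∈ cS`
  have key : ∀ x ∈ cS L β,
      (∫ y, cK L β x y * cΘ L β y ∂orthoTransverse L ≤ Real.exp (2 * ε) * (1 + ε) * (ρ₀ * κ * G) * Real.exp (-(stiffGaussExp L (β / 2) β (linkEmbed L x)))) ∧
      (‖linkEmbed L x‖ ≤ min (1 / 40) (powScale (1 / 2) β * btLog β) / 12 →
        (1 - Real.sqrt 2 ^ Fintype.card (Edge 3 L × Fin 3) * Real.exp (-(β / 2 * ((min (1 / 40) (powScale (1 / 2) β * btLog β)) ^ 2 / 4))) -
            Real.exp (-((min (1 / 40) (powScale (1 / 2) β * btLog β)) ^ 2 / 4 / (2 * powScale 1 β ^ 2))) * (2 : ℝ) ^ ((Module.finrank ℝ (gaugeModes L) : ℝ) / 2)) *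
          (Real.exp (-(2 * ε)) * (1 - ε)) * (ρ₀ * κ * G) * Real.exp (-(stiffGaussExp L (β / 2) β (linkEmbed L x))) ≤ ∫ y, cK L β x y * cΘ L β y ∂orthoTransverse L) := by
    intro x hx
    obtain ⟨p₀, hp₀⟩ : x ∈ Set.range (flatMap L β) := by rw [range_flatMap hβ0]; exact (mem_capBalancedSet_of_mem_cS (L := L) β hx).1
    have hX : linkEmbed L x = flatVec L β p₀ := by rw [← hp₀, linkEmbed_flatMap]
    -- the Hessian-form integrand
    set H : (Edge 3 L → Fin 3 → ℝ) → ℝ := fun y =>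
      Real.exp (-⟪linkEmbed L x, ((β / 2) • stiffHessian L) (linkEmbed L x)⟫) * Real.exp (-⟪linkEmbed L y, ((β / 2) • stiffHessian L) (linkEmbed L y)⟫) *
        Real.exp (-(β * ‖(linkEmbed L x - linkEmbed L y) - (gaugeModes L).starProjection (linkEmbed L x - linkEmbed L y)‖ ^ 2)) *
        Real.exp (-(‖(gaugeModes L).starProjection (linkEmbed L y)‖ ^ 2 / powScale 1 β ^ 2)) * Real.exp (-(stiffGaussExp L (β / 2) β (linkEmbed L y))) with hHdef
    have hHm : Measurable H := (continuous_hessForm (L := L) β (powScale 1 β) (linkEmbed L x)).measurable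
    have hH01 : ∀ y, 0 ≤ H y ∧ H y ≤ 1 := fun y => hessForm_mem_Icc (L := L) hβ0.le (powScale 1 β) (linkEmbed L x) y
    -- Step 1: restrict to `cS`
    have hJ : ∫ y, cK L β x y * cΘ L β y ∂orthoTransverse L = ∫ y in cS L β, cK L β x y * cΘ L β y ∂orthoTransverse L :=
      (setIntegral_eq_integral_of_forall_compl_eq_zero fun y hy => by rw [cΘ_eq_zero_of_not_mem_cS β y hy, mul_zero]).symm
    -- Step 2: the pointwise (A1) sandwich on `cS`
    have hpt : ∀ y ∈ cS L β, Real.exp (-(2 * ε)) * H y ≤ cK L β x y * cΘ L β y ∧ cK L β x y * cΘ L β y ≤ Real.exp (2 * ε) * H y := by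
      intro y hy
      obtain ⟨hΘy, -⟩ := cΘ_eq_on_cS (L := L) β hy
      obtain ⟨lx, ux⟩ := exp_neg_sandwich_of_abs_sub_le (hA1 x hx)
      obtain ⟨ly, uy⟩ := exp_neg_sandwich_of_abs_sub_le (hA1 y hy)
      -- the common nonnegative factor
      have hR : 0 ≤ Real.exp (-(β * ‖(linkEmbed L x - linkEmbed L y) - (gaugeModes L).starProjection (linkEmbed L x - linkEmbed L y)‖ ^ 2)) *
          (Real.exp (-(‖(gaugeModes L).starProjection (linkEmbed L y)‖ ^ 2 / powScale 1 β ^ 2)) * Real.exp (-(stiffGaussExp L (β / 2) β (linkEmbed L y)))) := by positivity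
      have e1 : Real.exp (-(β / 2 * (wilsonAction su2Rep (orthoTube L 1 x) + wilsonAction su2Rep (orthoTube L 1 y)))) =
          Real.exp (-(β / 2 * wilsonAction su2Rep (orthoTube L 1 x))) * Real.exp (-(β / 2 * wilsonAction su2Rep (orthoTube L 1 y))) := by
        rw [← Real.exp_add]; congr 1; ring
      have hsplit : cK L β x y * cΘ L β y =
          (Real.exp (-(β / 2 * wilsonAction su2Rep (orthoTube L 1 x))) * Real.exp (-(β / 2 * wilsonAction su2Rep (orthoTube L 1 y)))) *
            (Real.exp (-(β * ‖(linkEmbed L x - linkEmbed L y) - (gaugeModes L).starProjection (linkEmbed L x - linkEmbed L y)‖ ^ 2)) *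
              (Real.exp (-(‖(gaugeModes L).starProjection (linkEmbed L y)‖ ^ 2 / powScale 1 β ^ 2)) * Real.exp (-(stiffGaussExp L (β / 2) β (linkEmbed L y))))) := by
        unfold cK; rw [hΘy, map_sub, e1]; ring
      have hHsplit : H y = (Real.exp (-⟪linkEmbed L x, ((β / 2) • stiffHessian L) (linkEmbed L x)⟫) * Real.exp (-⟪linkEmbed L y, ((β / 2) • stiffHessian L) (linkEmbed L y)⟫)) *
            (Real.exp (-(β * ‖(linkEmbed L x - linkEmbed L y) - (gaugeModes L).starProjection (linkEmbed L x - linkEmbed L y)‖ ^ 2)) *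
              (Real.exp (-(‖(gaugeModes L).starProjection (linkEmbed L y)‖ ^ 2 / powScale 1 β ^ 2)) * Real.exp (-(stiffGaussExp L (β / 2) β (linkEmbed L y))))) := by
        simp only [hHdef]; ring
      have h2e : Real.exp (-(2 * ε)) = Real.exp (-ε) * Real.exp (-ε) := by rw [← Real.exp_add]; congr 1; ring
      have h2e' : Real.exp (2 * ε) = Real.exp ε * Real.exp ε := by rw [← Real.exp_add]; congr 1; ring
      rw [hsplit, hHsplit]
      constructor
      · have hm := mul_le_mul lx ly (by positivity) (Real.exp_pos _).le
        calc Real.exp (-(2 * ε)) * ((Real.exp (-⟪linkEmbed L x, ((β / 2) • stiffHessian L) (linkEmbed L x)⟫) * Real.exp (-⟪linkEmbed L y, ((β / 2) • stiffHessian L) (linkEmbed L y)⟫)) * _)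
            = (Real.exp (-ε) * Real.exp (-⟪linkEmbed L x, ((β / 2) • stiffHessian L) (linkEmbed L x)⟫)) *
                (Real.exp (-ε) * Real.exp (-⟪linkEmbed L y, ((β / 2) • stiffHessian L) (linkEmbed L y)⟫)) * _ := by rw [h2e]; ring
          _ ≤ _ := mul_le_mul_of_nonneg_right hm hR
      · have hm := mul_le_mul ux uy (Real.exp_pos _).le (by positivity)
        calc _ ≤ (Real.exp ε * Real.exp (-⟪linkEmbed L x, ((β / 2) • stiffHessian L) (linkEmbed L x)⟫)) *
              (Real.exp ε * Real.exp (-⟪linkEmbed L y, ((β / 2) • stiffHessian L) (linkEmbed L y)⟫)) * _ := mul_le_mul_of_nonneg_right hm hR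
          _ = _ := by rw [h2e']; ring
    -- integrability on `cS`
    have hKΘm : Measurable fun y => cK L β x y * cΘ L β y := ((measurable_cK (L := L) β).comp measurable_prodMk_left).mul (measurable_cΘ β)
    have hKΘint : IntegrableOn (fun y => cK L β x y * cΘ L β y) (cS L β) (orthoTransverse L) := by
      refine ((integrable_const (1 : ℝ)).mono' hKΘm.aestronglyMeasurable (ae_of_all _ fun y => ?_)).integrableOn
      rw [Real.norm_eq_abs, abs_of_nonneg (mul_nonneg (cK_pos_le_one (L := L) hβ0.le x y).1.le (cΘ_mem_Icc β y).1)]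
      exact mul_le_one₀ (cK_pos_le_one (L := L) hβ0.le x y).2 (cΘ_mem_Icc β y).1 (cΘ_mem_Icc β y).2.1
    have hHint : ∀ c : ℝ, IntegrableOn (fun y => c * H y) (cS L β) (orthoTransverse L) := fun c => by
      refine ((integrable_const |c|).mono' (hHm.const_mul c).aestronglyMeasurable (ae_of_all _ fun y => ?_)).integrableOn
      rw [Real.norm_eq_abs, abs_mul, abs_of_nonneg (hH01 y).1]
      exact mul_le_of_le_one_right (abs_nonneg c) (hH01 y).2
    -- Step 3: `π` versus `balLebesgue` on `cS`
    obtain ⟨hπlo, hπup⟩ := hπ H hHm (fun y => (hH01 y).1) ⟨1, fun y => (hH01 y).2⟩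
    -- Step 4/5: flat coordinates and the dictionary
    have hflatH : ∫ y in cS L β, H y ∂balLebesgue L = κ * ∫ p in flatMap L β ⁻¹' cS L β,
        (∏ i, Real.exp (-(flatA L β i * p₀.1 i ^ 2)) * Real.exp (-(flatB L β i * (p₀.1 i - p.1 i) ^ 2)) * Real.exp (-(flatA L β i * p.1 i ^ 2)) *
          Real.exp (-(π * p.1 i ^ 2))) * Real.exp (-(‖p.2‖ ^ 2 / powScale 1 β ^ 2)) ∂((volume : Measure (StiffIdx L β → ℝ)).prod (volume : Measure (gaugeModes L))) := by
      rw [hflat H hHm (cS L β) hSm, hvol]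
      congr 1
      refine setIntegral_congr_fun (hSm.preimage hTm) fun p _ => ?_
      simp only [hHdef]
      rw [linkEmbed_flatMap, hX, hessianIntegrand_flatVec hβ0 (powScale 1 β) p₀ p, Submodule.coe_norm]
    have hq : stiffGaussExp L (β / 2) β (linkEmbed L x) = ∑ i, π * p₀.1 i ^ 2 := by rw [hX, stiffGaussExp_flatVec hβ0, Finset.mul_sum]
    refine ⟨?_, fun hxI => ?_⟩
    · -- UPPER bound on `cS`
      have hup := sliceModel_upper (Z := gaugeModes L) (c := fun _ => π) ha hb hc0 hc hs0 p₀.1 (flatMap L β ⁻¹' cS L β)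
      calc ∫ y, cK L β x y * cΘ L β y ∂orthoTransverse L = ∫ y in cS L β, cK L β x y * cΘ L β y ∂orthoTransverse L := hJ
        _ ≤ ∫ y in cS L β, Real.exp (2 * ε) * H y ∂orthoTransverse L := setIntegral_mono_on hKΘint (hHint _) hSm fun y hy => (hpt y hy).2
        _ = Real.exp (2 * ε) * ∫ y in cS L β, H y ∂orthoTransverse L := integral_const_mul _ _
        _ ≤ Real.exp (2 * ε) * ((1 + ε) * ρ₀ * (κ * (G * Real.exp (-(∑ i, π * p₀.1 i ^ 2))))) := by
            refine mul_le_mul_of_nonneg_left (hπup.trans ?_) (Real.exp_pos _).le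
            rw [hflatH]
            exact mul_le_mul_of_nonneg_left (mul_le_mul_of_nonneg_left hup hκ.le) (by nlinarith)
        _ = Real.exp (2 * ε) * (1 + ε) * (ρ₀ * κ * G) * Real.exp (-(stiffGaussExp L (β / 2) β (linkEmbed L x))) := by rw [hq]; ring
    · -- LOWER bound on `I`
      have hE := flatMap_preimage_cS (L := L) (β := β) hr2
      have hw : ∀ i : StiffIdx L β, 0 ≤ flatScale L β i ^ 2 := fun i => sq_nonneg _
      have hθw : ∀ i : StiffIdx L β, β / 2 * (flatScale L β i ^ 2) ≤ (flatA L β i + flatB L β i + π) / 2 := fun i => by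
        have : flatB L β i = β * flatScale L β i ^ 2 := rfl
        linarith [ha i, Real.pi_pos]
      have hx8 : ∑ i, flatScale L β i ^ 2 * p₀.1 i ^ 2 ≤ (min (1 / 40) (powScale (1 / 2) β * btLog β)) ^ 2 / 8 := by
        have hn := norm_flatVec_sq (L := L) β p₀
        rw [← hX] at hn
        have h12 : ‖linkEmbed L x‖ ^ 2 ≤ (min (1 / 40) (powScale (1 / 2) β * btLog β) / 12) ^ 2 := pow_le_pow_left₀ (norm_nonneg _) hxI 2
        have hsum : ∑ i, flatScale L β i ^ 2 * p₀.1 i ^ 2 = ∑ i, (flatScale L β i * p₀.1 i) ^ 2 := Finset.sum_congr rfl fun i _ => by ring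
        rw [hsum]
        nlinarith [sq_nonneg ‖(p₀.2 : LinkSpace L)‖, sq_nonneg (min (1 / 40) (powScale (1 / 2) β * btLog β))]
      have hlo := sliceModel_lower (Z := gaugeModes L) (c := fun _ => π) ha hb hc0 hc hs0 (w := fun i => flatScale L β i ^ 2) hw (θ := β / 2) (by positivity) hθw
        (r := min (1 / 40) (powScale (1 / 2) β * btLog β)) (x := p₀.1) hx8
      try beta_reduce at hlo
      -- the set of `sliceModel_lower` is `flatMap⁻¹ cS`
      have hset : {p : (StiffIdx L β → ℝ) × gaugeModes L | ∑ i, flatScale L β i ^ 2 * p.1 i ^ 2 + ‖p.2‖ ^ 2 ≤ (min (1 / 40) (powScale (1 / 2) β * btLog β)) ^ 2} =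
          flatMap L β ⁻¹' cS L β := by
        rw [hE]; ext p
        simp only [Set.mem_setOf_eq, mul_pow, Submodule.coe_norm]
      rw [hset] at hlo
      -- weaken the stiff count to `|Edge × Fin 3|`
      have hcard : Fintype.card (StiffIdx L β) ≤ Fintype.card (Edge 3 L × Fin 3) := by
        have h := Fintype.card_le_of_injective (fun i : StiffIdx L β => i.1) (fun a b h => Subtype.ext h)
        simpa [Fintype.card_fin] using h
      have hτ : (1 - Real.sqrt 2 ^ Fintype.card (Edge 3 L × Fin 3) * Real.exp (-(β / 2 * ((min (1 / 40) (powScale (1 / 2) β * btLog β)) ^ 2 / 4))) -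
            Real.exp (-((min (1 / 40) (powScale (1 / 2) β * btLog β)) ^ 2 / 4 / (2 * powScale 1 β ^ 2))) * (2 : ℝ) ^ ((Module.finrank ℝ (gaugeModes L) : ℝ) / 2)) ≤
          (1 - Real.sqrt 2 ^ Fintype.card (StiffIdx L β) * Real.exp (-(β / 2 * ((min (1 / 40) (powScale (1 / 2) β * btLog β)) ^ 2 / 4))) -
            Real.exp (-((min (1 / 40) (powScale (1 / 2) β * btLog β)) ^ 2 / 4 / (2 * powScale 1 β ^ 2))) * (2 : ℝ) ^ ((Module.finrank ℝ (gaugeModes L) : ℝ) / 2)) := by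
        have h1 : Real.sqrt 2 ^ Fintype.card (StiffIdx L β) ≤ Real.sqrt 2 ^ Fintype.card (Edge 3 L × Fin 3) :=
          pow_le_pow_right₀ (Real.one_le_sqrt.mpr (by norm_num)) hcard
        have h2 := mul_le_mul_of_nonneg_right h1 (Real.exp_pos (-(β / 2 * ((min (1 / 40) (powScale (1 / 2) β * btLog β)) ^ 2 / 4)))).le
        linarith
      have h1e : 0 ≤ 1 - ε := by linarith
      have hpos : 0 ≤ Real.exp (-(2 * ε)) * (1 - ε) * (ρ₀ * κ * G) * Real.exp (-(stiffGaussExp L (β / 2) β (linkEmbed L x))) := by positivity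
      calc (1 - Real.sqrt 2 ^ Fintype.card (Edge 3 L × Fin 3) * Real.exp (-(β / 2 * ((min (1 / 40) (powScale (1 / 2) β * btLog β)) ^ 2 / 4))) -
              Real.exp (-((min (1 / 40) (powScale (1 / 2) β * btLog β)) ^ 2 / 4 / (2 * powScale 1 β ^ 2))) * (2 : ℝ) ^ ((Module.finrank ℝ (gaugeModes L) : ℝ) / 2)) *
            (Real.exp (-(2 * ε)) * (1 - ε)) * (ρ₀ * κ * G) * Real.exp (-(stiffGaussExp L (β / 2) β (linkEmbed L x)))
          = (1 - Real.sqrt 2 ^ Fintype.card (Edge 3 L × Fin 3) * Real.exp (-(β / 2 * ((min (1 / 40) (powScale (1 / 2) β * btLog β)) ^ 2 / 4))) -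
              Real.exp (-((min (1 / 40) (powScale (1 / 2) β * btLog β)) ^ 2 / 4 / (2 * powScale 1 β ^ 2))) * (2 : ℝ) ^ ((Module.finrank ℝ (gaugeModes L) : ℝ) / 2)) *
            (Real.exp (-(2 * ε)) * (1 - ε) * (ρ₀ * κ * G) * Real.exp (-(stiffGaussExp L (β / 2) β (linkEmbed L x)))) := by ring
        _ ≤ (1 - Real.sqrt 2 ^ Fintype.card (StiffIdx L β) * Real.exp (-(β / 2 * ((min (1 / 40) (powScale (1 / 2) β * btLog β)) ^ 2 / 4))) -
              Real.exp (-((min (1 / 40) (powScale (1 / 2) β * btLog β)) ^ 2 / 4 / (2 * powScale 1 β ^ 2))) * (2 : ℝ) ^ ((Module.finrank ℝ (gaugeModes L) : ℝ) / 2)) *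
            (Real.exp (-(2 * ε)) * (1 - ε) * (ρ₀ * κ * G) * Real.exp (-(stiffGaussExp L (β / 2) β (linkEmbed L x)))) := mul_le_mul_of_nonneg_right hτ hpos
        _ = Real.exp (-(2 * ε)) * ((1 - ε) * ρ₀ * (κ * ((1 - Real.sqrt 2 ^ Fintype.card (StiffIdx L β) * Real.exp (-(β / 2 * ((min (1 / 40) (powScale (1 / 2) β * btLog β)) ^ 2 / 4))) -
              Real.exp (-((min (1 / 40) (powScale (1 / 2) β * btLog β)) ^ 2 / 4 / (2 * powScale 1 β ^ 2))) * (2 : ℝ) ^ ((Module.finrank ℝ (gaugeModes L) : ℝ) / 2)) *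
                (G * Real.exp (-(∑ i, π * p₀.1 i ^ 2)))))) := by rw [hq]; ring
        _ ≤ Real.exp (-(2 * ε)) * ((1 - ε) * ρ₀ * (κ * ∫ p in flatMap L β ⁻¹' cS L β,
              (∏ i, Real.exp (-(flatA L β i * p₀.1 i ^ 2)) * Real.exp (-(flatB L β i * (p₀.1 i - p.1 i) ^ 2)) * Real.exp (-(flatA L β i * p.1 i ^ 2)) *
                Real.exp (-(π * p.1 i ^ 2))) * Real.exp (-(‖p.2‖ ^ 2 / powScale 1 β ^ 2)) ∂((volume : Measure (StiffIdx L β → ℝ)).prod (volume : Measure (gaugeModes L))))) :=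
            mul_le_mul_of_nonneg_left (mul_le_mul_of_nonneg_left (mul_le_mul_of_nonneg_left hlo hκ.le) (by positivity)) (Real.exp_pos _).le
        _ = Real.exp (-(2 * ε)) * ((1 - ε) * ρ₀ * ∫ y in cS L β, H y ∂balLebesgue L) := by rw [hflatH]
        _ ≤ Real.exp (-(2 * ε)) * ∫ y in cS L β, H y ∂orthoTransverse L := mul_le_mul_of_nonneg_left hπlo (Real.exp_pos _).le
        _ = ∫ y in cS L β, Real.exp (-(2 * ε)) * H y ∂orthoTransverse L := (integral_const_mul _ _).symm
        _ ≤ ∫ y in cS L β, cK L β x y * cΘ L β y ∂orthoTransverse L := setIntegral_mono_on (hHint _) hKΘint hSm fun y hy => (hpt y hy).1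
        _ = ∫ y, cK L β x y * cΘ L β y ∂orthoTransverse L := hJ.symm
  exact ⟨ρ₀ * κ * G, by positivity, fun x hx => (key x hx).1, fun x hx hxI => (key x hx).2 hxI⟩

/-! ## §3 The schedule form -/

/-- `β·r_f(β)² → ∞` (`r_f = min(1/40, β^{-1/2}ℓ)`, `β·(β^{-1/2}ℓ)² = ℓ²`). [folklore] -/
theorem tendsto_beta_mul_rf_sq : Tendsto (fun β : ℝ => β * (min (1 / 40) (powScale (1 / 2) β * btLog β)) ^ 2) atTop atTop := by
  refine Filter.tendsto_atTop.2 fun b => ?_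
  filter_upwards [eventually_ge_atTop (1 : ℝ), eventually_ge_atTop (1600 * b), Real.tendsto_log_atTop.eventually_ge_atTop b] with β hβ1 hβb hlog
  have hℓ1 : 1 ≤ btLog β := one_le_btLog β
  have hℓ : b ≤ btLog β ^ 2 := by
    have : Real.log β ≤ btLog β := le_max_left _ _
    nlinarith
  rcases min_choice (1 / 40 : ℝ) (powScale (1 / 2) β * btLog β) with h | h <;> rw [h]
  · linarith
  · rw [mul_pow, powScale_half_sq hβ1, ← mul_assoc, mul_inv_cancel₀ (by linarith), one_mul]; exact hℓ

/-- `r_f(β)²/β^{-2} → ∞`. [folklore] -/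
theorem tendsto_rf_sq_div : Tendsto (fun β : ℝ => (min (1 / 40) (powScale (1 / 2) β * btLog β)) ^ 2 / powScale 1 β ^ 2) atTop atTop := by
  refine tendsto_atTop_mono' atTop ?_ tendsto_beta_mul_rf_sq
  filter_upwards [eventually_ge_atTop (1 : ℝ)] with β hβ1
  have hp : powScale 1 β = β⁻¹ := by rw [← powScale_half_sq' β, powScale_half_sq hβ1]
  rw [hp, inv_pow, div_inv_eq_mul]
  have hr := sq_nonneg (min (1 / 40) (powScale (1 / 2) β * btLog β))
  nlinarith [mul_le_mul_of_nonneg_left (show β ≤ β ^ 2 by nlinarith) hr]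

/-- The two truncation tails of ✓`sliceModel_lower` vanish along the schedule: for `δ > 0`, eventually `√2^{3|E|}e^{−βr_f²/8} ≤ δ` and `2^{dim Γ/2}e^{−r_f²β²/8} ≤ δ`. [folklore] -/
theorem eventually_slice_tails_le {δ : ℝ} (hδ : 0 < δ) :
    ∀ᶠ β : ℝ in atTop, Real.sqrt 2 ^ Fintype.card (Edge 3 L × Fin 3) * Real.exp (-(β / 2 * ((min (1 / 40) (powScale (1 / 2) β * btLog β)) ^ 2 / 4))) ≤ δ ∧
      Real.exp (-((min (1 / 40) (powScale (1 / 2) β * btLog β)) ^ 2 / 4 / (2 * powScale 1 β ^ 2))) * (2 : ℝ) ^ ((Module.finrank ℝ (gaugeModes L) : ℝ) / 2) ≤ δ := by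
  have h1 : Tendsto (fun β : ℝ => Real.sqrt 2 ^ Fintype.card (Edge 3 L × Fin 3) * Real.exp (-(β / 2 * ((min (1 / 40) (powScale (1 / 2) β * btLog β)) ^ 2 / 4)))) atTop (𝓝 0) := by
    have h : Tendsto (fun β : ℝ => β / 2 * ((min (1 / 40) (powScale (1 / 2) β * btLog β)) ^ 2 / 4)) atTop atTop := by
      have := tendsto_beta_mul_rf_sq.const_mul_atTop (show (0 : ℝ) < 1 / 8 by norm_num)
      refine this.congr fun β => ?_
      ring
    simpa using (Real.tendsto_exp_neg_atTop_nhds_zero.comp h).const_mul (Real.sqrt 2 ^ Fintype.card (Edge 3 L × Fin 3))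
  have h2 : Tendsto (fun β : ℝ => Real.exp (-((min (1 / 40) (powScale (1 / 2) β * btLog β)) ^ 2 / 4 / (2 * powScale 1 β ^ 2))) * (2 : ℝ) ^ ((Module.finrank ℝ (gaugeModes L) : ℝ) / 2)) atTop (𝓝 0) := by
    have h : Tendsto (fun β : ℝ => (min (1 / 40) (powScale (1 / 2) β * btLog β)) ^ 2 / 4 / (2 * powScale 1 β ^ 2)) atTop atTop := by
      have := tendsto_rf_sq_div.const_mul_atTop (show (0 : ℝ) < 1 / 8 by norm_num)
      refine this.congr fun β => ?_
      field_simp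
      ring
    simpa using (Real.tendsto_exp_neg_atTop_nhds_zero.comp h).mul_const ((2 : ℝ) ^ ((Module.finrank ℝ (gaugeModes L) : ℝ) / 2))
  filter_upwards [h1.eventually (eventually_le_nhds hδ), h2.eventually (eventually_le_nhds hδ)] with β hb1 hb2
  exact ⟨hb1, hb2⟩

/-- ★★★ **TWO-SIDED SLICE INTEGRAL along the schedule**: for every `σ₁ > 0`, eventually in `β` there is ONE level `Λ > 0` with
`∫_y cK(x,y)cΘ(y)dπ ≤ (1+σ₁)·Λ·e^{−q_β(x̂)}` for all `x ∈ cS` and `(1−σ₁)·Λ·e^{−q_β(x̂)} ≤ ∫_y cK(x,y)cΘ(y)dπ` for all `x ∈ cS` with `‖x̂‖ ≤ r_f/12`. [cite: Wipf2021, §8.5.1 (8.56)–(8.57)] -/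
theorem eventually_slice_two_sided {σ₁ : ℝ} (hσ₁ : 0 < σ₁) :
    ∀ᶠ β : ℝ in atTop, ∃ Λ : ℝ, 0 < Λ ∧
      (∀ x ∈ cS L β, ∫ y, cK L β x y * cΘ L β y ∂orthoTransverse L ≤ (1 + σ₁) * Λ * Real.exp (-(stiffGaussExp L (β / 2) β (linkEmbed L x)))) ∧
      (∀ x ∈ cS L β, ‖linkEmbed L x‖ ≤ min (1 / 40) (powScale (1 / 2) β * btLog β) / 12 →
        (1 - σ₁) * Λ * Real.exp (-(stiffGaussExp L (β / 2) β (linkEmbed L x))) ≤ ∫ y, cK L β x y * cΘ L β y ∂orthoTransverse L) := by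
  obtain ⟨ρ₀, hρ₀, hπ⟩ := setIntegral_cS_sharp L
  set σ : ℝ := min σ₁ 1 with hσ
  have hσ0 : 0 < σ := lt_min hσ₁ one_pos
  have hσ1 : σ ≤ 1 := min_le_right _ _
  have hσσ : σ ≤ σ₁ := min_le_left _ _
  set ε : ℝ := σ / 8 with hε
  have hε0 : 0 < ε := by positivity
  have hε1 : ε < 1 := by rw [hε]; linarith
  -- constants algebra
  have hexp_up : Real.exp (2 * ε) ≤ 1 + 2 * ε + (2 * ε) ^ 2 := by
    have h := Real.abs_exp_sub_one_sub_id_le (x := 2 * ε) (by rw [abs_of_pos (by positivity)]; linarith)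
    have := (abs_le.mp h).2; linarith
  have hexp_lo : 1 - 2 * ε ≤ Real.exp (-(2 * ε)) := by linarith [Real.add_one_le_exp (-(2 * ε))]
  have hU : Real.exp (2 * ε) * (1 + ε) ≤ 1 + σ := by rw [hε] at hexp_up ⊢; nlinarith [Real.exp_pos (2 * (σ / 8))]
  filter_upwards [eventually_action_hessian_cS (L := L) hε0, hπ ε hε0 hε1, eventually_slice_tails_le (L := L) (show 0 < σ / 4 by positivity),
    eventually_ge_atTop (1 : ℝ)] with β hA1 hπβ ⟨hτ1, hτ2⟩ hβ1
  obtain ⟨Λ, hΛ, hup, hlo⟩ := slice_two_sided_at (L := L) hβ1 hε0 hε1 hρ₀ hA1 hπβ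
  refine ⟨Λ, hΛ, fun x hx => (hup x hx).trans ?_, fun x hx hxI => le_trans ?_ (hlo x hx hxI)⟩
  · have h0 : 0 ≤ Λ * Real.exp (-(stiffGaussExp L (β / 2) β (linkEmbed L x))) := by positivity
    calc Real.exp (2 * ε) * (1 + ε) * Λ * Real.exp (-(stiffGaussExp L (β / 2) β (linkEmbed L x)))
        = (Real.exp (2 * ε) * (1 + ε)) * (Λ * Real.exp (-(stiffGaussExp L (β / 2) β (linkEmbed L x)))) := by ring
      _ ≤ (1 + σ₁) * (Λ * Real.exp (-(stiffGaussExp L (β / 2) β (linkEmbed L x)))) := mul_le_mul_of_nonneg_right (hU.trans (by linarith)) h0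
      _ = _ := by ring
  · have h0 : 0 ≤ Λ * Real.exp (-(stiffGaussExp L (β / 2) β (linkEmbed L x))) := by positivity
    have hL : 1 - σ₁ ≤ (1 - Real.sqrt 2 ^ Fintype.card (Edge 3 L × Fin 3) * Real.exp (-(β / 2 * ((min (1 / 40) (powScale (1 / 2) β * btLog β)) ^ 2 / 4))) -
        Real.exp (-((min (1 / 40) (powScale (1 / 2) β * btLog β)) ^ 2 / 4 / (2 * powScale 1 β ^ 2))) * (2 : ℝ) ^ ((Module.finrank ℝ (gaugeModes L) : ℝ) / 2)) *
          (Real.exp (-(2 * ε)) * (1 - ε)) := by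
      have hA : 1 - σ / 2 ≤ 1 - Real.sqrt 2 ^ Fintype.card (Edge 3 L × Fin 3) * Real.exp (-(β / 2 * ((min (1 / 40) (powScale (1 / 2) β * btLog β)) ^ 2 / 4))) -
          Real.exp (-((min (1 / 40) (powScale (1 / 2) β * btLog β)) ^ 2 / 4 / (2 * powScale 1 β ^ 2))) * (2 : ℝ) ^ ((Module.finrank ℝ (gaugeModes L) : ℝ) / 2) := by linarith
      have hB : 1 - σ / 2 ≤ Real.exp (-(2 * ε)) * (1 - ε) := by
        rw [hε] at hexp_lo ⊢; nlinarith [Real.exp_pos (-(2 * (σ / 8)))]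
      have hA0 : 0 ≤ 1 - σ / 2 := by linarith
      calc 1 - σ₁ ≤ (1 - σ / 2) * (1 - σ / 2) := by nlinarith
        _ ≤ _ := mul_le_mul hA hB hA0 (hA0.trans hA)
    calc (1 - σ₁) * Λ * Real.exp (-(stiffGaussExp L (β / 2) β (linkEmbed L x))) = (1 - σ₁) * (Λ * Real.exp (-(stiffGaussExp L (β / 2) β (linkEmbed L x)))) := by ring
      _ ≤ _ := mul_le_mul_of_nonneg_right hL h0
      _ = _ := by ring

end Summit.QuantumFields.YangMills.Theorems.FemtoTransferGap.TwoLattice.ConstTube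

end
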